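import Summits.BirchSwinnertonDyer.BirchSwinnertonDyer.Theses.SignedLowerHalves
import Summits.BirchSwinnertonDyer.BirchSwinnertonDyer.Theorems.SignedLowerHalvesKobayashiMainConjectureSmallImageSignedMuOneSign
import HarnessLib

/-!
# Route `SignedLowerHalves`, crux `KobayashiMainConjectureSmallImage` (item stmt-BirchSwinnertonDyer-19002):
# the EULER-SYSTEM `μ`-TRANSFER at NON-SURJECTIVE image, part 5 — the crux BY NAME from its registered
# Eisenstein stub and the ONE-SIGN analytic rider (cell `bsd-ssimc`, WIDTH-LEVER lane B = seat
# `bsd-ssimc-k3-c4x` g0; helper file, `--supports stmt-BirchSwinnertonDyer-19002 --as helper`; the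
# route-importing closer kept in its own small file so that parts 1–4 stay route-independent)

HONEST FRAMING.  One theorem, CONDITIONAL on displayed binders: the construction fact
`Kobayashi2003.thm62_63_73_signedColemanKato_zeta` (p529649, reviewed), the published facts Kobayashi
Thm. 1.2 / Thm. 4.1 RATIONAL / the period-unit pair, the statement of the registered stub
`stub_lowerSmallImage` (the Eisenstein half at small image — OPEN, no engine in print) and the
class-wide ONE-SIGN analytic rider (for the newform of conductor level ONE of the two signed Pollack
functions has a `p`-adic unit coefficient — the Perrin-Riou–Pollack `μ = 0` for one sign; open
class-wide, a finite certificate per pair).  Nothing is booked; crux 4 stays OPEN; BSD is not proved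
by any of this.  PARTITION (cell bsd-ssimc): X7 (A7) × item 4's entire domain — types-the-object-of;
closes NONE.

References: [Kobayashi2003] Thm. 1.2, 4.1, 6.2, 6.3, 7.3; [Kato2004Asterisque] Thm. 12.6, §13.8; tree:
parts 1–4 (this seat: p528404, p529649, p532179, p533653), the route file (crux 4 decl), the
registered skeleton `Cruxes/KobayashiMainConjectureSmallImage/Lines/birth.lean` (sha16 b1bf5b11c746572b).
-/

set_option linter.dupNamespace false
set_option autoImplicit false

noncomputable section

open scoped Classical MatrixGroups ModularForm

open CongruenceSubgroup WeierstrassCurve Field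
  Literature.NumberTheory.EllipticCurves Literature.NumberTheory.EllipticCurves.ModularForms
  Literature.NumberTheory.EllipticCurves.Rank1Residual
  Literature.NumberTheory.EllipticCurves.Kobayashi2003
  Literature.NumberTheory.EllipticCurves.GreenbergVatsal2000

namespace Summit.BirchSwinnertonDyer.BirchSwinnertonDyer.Theorems.SmallImageSignedMuTransfer

/-- **Crux 4 BY NAME from its Eisenstein stub and the ONE-SIGN rider** — the registered skeleton's
composition `KobayashiMainConjectureSmallImage_of` with `stub_saturationSmallImage` DISCHARGED by
part 4 (`stub_saturationSmallImage_of_signedMuAn_oneSign`): granted `hCK`, `h12`, `h41`, `h5`, `h3`,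
the statement of `stub_lowerSmallImage` (`hlower`) and the one-sign rider `hμan₀`, the route decl
`Theses.SignedLowerHalves.KobayashiMainConjectureSmallImage` holds.  So crux 4 READS: «Eisenstein half
∧ (for one sign) `μ(L_p^±(E)) = 0` on the class», modulo published facts plus ONE reviewed
construction fact.  CONDITIONAL; nothing asserted beyond the binders; nothing booked.
[cite: Kobayashi2003, Thm. 4.1 (p. 8), Thm. 6.3 (p. 11), Thm. 7.3 (p. 13) and p. 2 (the main [C])]
[cite: Kato2004Asterisque, Thm. 12.6 (p. 222), §13.8 (pp. 228–229)] -/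
theorem kobayashiMainConjectureSmallImage_of_lower_of_signedMuAn_oneSign
    (hCK : thm62_63_73_signedColemanKato_zeta)
    (h12 : Kobayashi2003.thm12_signedSelmerDual_finite_torsion)
    (h41 : Kobayashi2003.thm41_signedCharIdeal_divisibility)
    (h5 : realPeriodRat_eq_unit_mul_plusPeriod) (h3 : realPeriodRat_eq_unit_mul_plusPeriod_three)
    (hlower : ∀ (W : WeierstrassCurve ℚ) [W.IsElliptic] [W.IsGloballyMinimal] (p : ℕ) [Fact p.Prime],
      p ≠ 2 → ClassX7 W p → ¬ W.HasCM → W.frobeniusTrace p = 0 → ¬ Surj W p →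
      ∃ ε : ℤˣ, Summit.BirchSwinnertonDyer.Rank1Residual.Supersingular.KobayashiLowerDivisibility W p ε)
    (hμan₀ : ∀ (W : WeierstrassCurve ℚ) [W.IsElliptic] [W.IsGloballyMinimal] (p : ℕ) [Fact p.Prime],
      p ≠ 2 → ClassX7 W p → ¬ W.HasCM → W.frobeniusTrace p = 0 → ¬ Surj W p →
      ∀ [NeZero (W.conductorNorm ℤ)] (f : CuspForm (Gamma0 (W.conductorNorm ℤ)) 2),
      IsNewformOf W f → ∃ (ε₀ : ℤˣ) (L₀ : IwasawaAlgebra p),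
        IsSignedPAdicLFunction f p ε₀ L₀ ∧ HasUnitContent L₀) :
    Summit.BirchSwinnertonDyer.BirchSwinnertonDyer.Theses.SignedLowerHalves.KobayashiMainConjectureSmallImage := by
  intro W _ _ p _ hp hX hcm hap hs
  obtain ⟨ε, hε⟩ := hlower W p hp hX hcm hap hs
  exact ⟨ε, stub_saturationSmallImage_of_signedMuAn_oneSign hCK h12 h41 h5 h3 hμan₀ W p hp hX hcm hap
    hs ε hε⟩

end Summit.BirchSwinnertonDyer.BirchSwinnertonDyer.Theorems.SmallImageSignedMuTransfer

end
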